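import Summits.QuantumFields.GaugeBoot.Rows.KZL2rpD4RowDefs
import Summits.QuantumFields.GaugeBoot.Rows.KZL2rpD4BlkDefs
import Summits.QuantumFields.GaugeBoot.Rows.KZL2rpD4Extra
import HarnessLib

/-!
# Gauge-boot: the class functions of the symmetry-factorised reduction identity

Cell `pub-gaugeboot` (HOME `run/shared/lean/pub/pub-gaugeboot/`), seat lean1 (SYMMETRY-FACTORISED torus layer for the kz-L2-rp-4D family =
rows C91–C106 / C123–C127; label set, lines, irrep data, pair/row class certification, orbit tables, reduction identity, assembly).

HONEST FRAMING (page 1 of every file of this cell): certified bounds on lattice expectations at STATED coupling,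
gauge group, dimension and torus size; NOT a mass gap, NOT a continuum limit, NOT a string tension, NOT large `N`.
The venture is explicitly NOT Yang–Mills-summit-bearing (barriers `FixedCouplingUltralocality`,
`PerturbativeInvisibility`).

`clsFnH k i q`, `clsFnS k i q`, `clsFnL k i q`: for block `k`, row `i` and packed column/support index `q = 1024·j + t`, the problem variable
of the raw word `(row_i, t·row_j)` read through the row transport tables (`…RowAsm`) and the orbit tables (`…BlkDefs`).  Shared by the
kernel identities `…RedChk…` and the assembly `…Red…`.
-/

noncomputable section

open Literature.MathematicalPhysics.QuantumFieldTheory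

namespace Summit.QuantumFields.GaugeBoot

namespace KZL2rpD4

/-- Class function (Hermitian blocks). -/
def clsFnH (k : Fin 70) (i q : ℕ) : ℕ := (rowClsH (hRow k i).val (orbH k (q / 1024) (q % 1024)).val).val

/-- Class function (site blocks). -/
def clsFnS (k : Fin 70) (i q : ℕ) : ℕ := (rowClsS (rRow k i).val (orbR k (q / 1024) (q % 1024)).val).val

/-- Class function (link blocks). -/
def clsFnL (k : Fin 70) (i q : ℕ) : ℕ := (rowClsL (rRow k i).val (orbR k (q / 1024) (q % 1024)).val).val

end KZL2rpD4

end Summit.QuantumFields.GaugeBoot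

end
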